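import Summits.QuantumFields.YangMills.Theorems.BalabanUVNodesN19KinkExactSignJackson

/-!
# YM-DAG node N19 (= NE7 proper) — THE KINK-EXACT APPROXIMANTS VANISH QUADRATICALLY AT THE KINK:
# `|r_L(x)| ≤ (π∕2)·L·|x|` and `|p_L(x)| ≤ (π∕2)·L·x²` on `[−1,1]` (so `|p_{2L} − p_L| ≤ (3π∕2)·L·x²`: coarse levels barely see fine-scale coordinates)

Cell `pub-ymgap`, HUMAN RULING D-0062 (Track A) ∕ D-0149 (work-bound push), R141 (C) wider-strategy seat `pub-ymgap-dag-n19-e` (strategy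
s3 = ALTERNATIVE CURRENCY), generation g36, module 4 (lineage module 199).  Route `Summits/QuantumFields/YangMills/Theses/BalabanUVNodes.lean`,
cluster item K3⁸ «SpineGivenEndpointR13SepCoPHV» (stmt-QuantumFields-27366); filed `--supports` that item `--as helper` (it proves no registered
stub).  COUNT-NEUTRAL: elementary real analysis over Mathlib (`abs_max_sub_max_le_max`, `Real.mul_le_sin`, `Real.cos_arccos`) and, BY NAME, module 165
`…N19JacksonKernelMean` (`abs_jacksonMean_sub_jacksonMean_le`: the positive kernel keeps Lipschitz constants), module 185 (`abs_jacksonMean_le`) and module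
196 `…N19KinkExactSignJackson` (`exists_chebyshev_eval_eq_jacksonMean`, the clipped cosine, `clipCos_eq_sign`, `abs_jacksonMean_sub_le_of_locallyConst`,
`self_mul_sign_eq_abs`); no laws, no scheme object, no Theses import; NOT a discharge claim.

ROLE IN THE LINEAGE (HOME `numerics/OPEN-PROBLEM.md`, g36 blocks).  Module 197 puts the dyadic level statistics of the kink-exact ladder in a CROSS-POLYTOPE
(`Σ_l|θ_l| ≲ 1`).  The finer structure used by the g36 semiclassical reading is that a coordinate at scale `2^{−j}` loads a COARSER level `l < j` only by
`≍ 4^{l−j}` of that level's range — the accessible set hugs the coordinate corners of the simplex.  This is the pointwise statement `|p_{2^{l+1}}(x) −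
p_{2^l}(x)| ≤ (3π∕2)·2^l·x²`, a consequence of (§1) `|r_L(x)| ≤ (π∕2)L|x|` for module 196's sign polynomial (`r_L(cos θ)` = the Jackson mean of the clipped
cosine, which is `L`-Lipschitz — kept by the positive kernel — and VANISHES at `θ = π∕2` by oddness; then Jordan's `|θ − π∕2| ≤ (π∕2)|cos θ|`) and hence
`|p_L(x)| = |x·r_L(x)| ≤ (π∕2)L·x²`: ★ `exists_poly_near_sign_localized_linear`, ★★ `exists_kinkExact_poly_near_abs_quadratic` (module 196's two main
theorems with the extra clause; same construction).

HONEST FRAMING (binding).  Elementary and [folklore]; NO consumer in the DAG today (a structural remark on the seat's own upper-bound method); nothing of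
Bałaban's instantiated; NE7 NOT PRINTED, NOT proved; N19 NOT discharged; count-neutral.  One finite `T⁴` programme at fixed `ε`; nothing continuum ∕ `ℝ⁴` ∕
OS ∕ mass-gap ∕ Clay.  0 `def` ∕ 0 `sorry`.
-/

noncomputable section

open Finset MeasureTheory intervalIntegral Polynomial
open scoped Real

namespace Summit.QuantumFields.YangMills.Theorems.BalabanUVNodesN19KinkExactQuadraticVanishing

open Literature.Probability.LatticeModels (fejerKernel)
open Summit.QuantumFields.YangMills.Theorems.BalabanUVNodesN19FejerMean (fejerKernel_neg)
open Summit.QuantumFields.YangMills.Theorems.BalabanUVNodesN19JacksonMeanSecondOrder (abs_jacksonMean_le)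
open Summit.QuantumFields.YangMills.Theorems.BalabanUVNodesN19KinkExactSignJackson
  (exists_chebyshev_eval_eq_jacksonMean continuous_clipCos periodic_clipCos clipCos_neg abs_clipCos_le clipCos_eq_sign
    abs_jacksonMean_sub_le_of_locallyConst self_mul_sign_eq_abs)

/-! ## §1 Quadratic vanishing at the kink: `|r_L(x)| ≤ (π∕2)L|x|`, `|p_L(x)| ≤ (π∕2)L·x²` [folklore]

WHY (HOME `numerics/OPEN-PROBLEM.md`, g36 refinement).  The level increments of the ladder built on `p_{2^l}` must (nearly) VANISH at coordinates much
finer than the level's scale for the accessible set of level statistics to have the simplex-corner structure: `|p_{2^{l+1}}(x) − p_{2^l}(x)| ≤ (3π∕2)·2^l·x²`,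
i.e. a coordinate at scale `2^{−j}` loads level `l < j` only by `≍ 4^{l−j}` of that level's range.  This follows from the Lipschitz constant `L` of the
clipped cosine (kept by the positive Jackson kernel, module 165) and the vanishing of its Jackson mean at `θ = π∕2` (odd integrand), via Jordan's inequality. -/

/-- The clip `max(−1, min(1, ·))` is `1`-Lipschitz. [bookkeeping] -/
theorem abs_clipOne_sub_clipOne_le (s t : ℝ) : |max (-1) (min 1 s) - max (-1) (min 1 t)| ≤ |s - t| := by
  refine (abs_max_sub_max_le_max _ _ _ _).trans (max_le (by simp) ?_)
  exact (abs_min_sub_min_le_max _ _ _ _).trans (max_le (by simp) le_rfl)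

/-- The clipped cosine is `L`-Lipschitz. [bookkeeping] -/
theorem abs_clipCos_sub_clipCos_le (L : ℕ) (a b : ℝ) :
    |max (-1) (min 1 ((L : ℝ) * Real.cos a)) - max (-1) (min 1 ((L : ℝ) * Real.cos b))| ≤ (L : ℝ) * |a - b| := by
  refine (abs_clipOne_sub_clipOne_le _ _).trans ?_
  rw [← mul_sub, abs_mul, abs_of_nonneg (by positivity : (0 : ℝ) ≤ L)]
  exact mul_le_mul_of_nonneg_left (Real.abs_cos_sub_cos_le _ _) (by positivity)

/-- The clip is odd: `clip(−s) = −clip(s)`. [bookkeeping] -/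
theorem clipOne_neg (s : ℝ) : max (-1) (min 1 (-s)) = -max (-1) (min 1 s) := by
  simp only [max_def, min_def]
  split_ifs <;> linarith

/-- **THE JACKSON MEAN OF THE CLIPPED COSINE VANISHES AT `θ = π∕2`** (the integrand `clip(L sin v)·f_L(v)²` is odd). [folklore] -/
theorem jacksonMean_clipCos_pi_div_two (L : ℕ) (Z : ℝ) :
    (1 / Z) * ∫ v in (-π)..π, max (-1) (min 1 ((L : ℝ) * Real.cos (π / 2 - v))) * fejerKernel L v ^ 2 = 0 := by
  have h := intervalIntegral.integral_comp_neg (a := -π) (b := π)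
    (fun v : ℝ => max (-1) (min 1 ((L : ℝ) * Real.cos (π / 2 - v))) * fejerKernel L v ^ 2)
  simp only [neg_neg] at h
  have h2 : (fun v : ℝ => max (-1) (min 1 ((L : ℝ) * Real.cos (π / 2 - -v))) * fejerKernel L (-v) ^ 2) =
      fun v => -(max (-1) (min 1 ((L : ℝ) * Real.cos (π / 2 - v))) * fejerKernel L v ^ 2) := by
    funext v
    rw [fejerKernel_neg, sub_neg_eq_add, add_comm, Real.cos_add_pi_div_two, Real.cos_pi_div_two_sub, mul_neg, clipOne_neg]
    ring
  rw [h2, intervalIntegral.integral_neg] at h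
  have : ∫ v in (-π)..π, max (-1) (min 1 ((L : ℝ) * Real.cos (π / 2 - v))) * fejerKernel L v ^ 2 = 0 := by linarith
  rw [this, mul_zero]

/-- **THE JACKSON MEAN OF THE CLIPPED COSINE IS SMALL NEAR `π∕2`**: `|(1∕Z_L)∫ g_L(θ − v)f_L(v)² dv| ≤ L·|θ − π∕2|` (`L ≥ 1`; Lipschitz constant `L`
through the positive kernel, and the value `0` at `π∕2`). [folklore] -/
theorem abs_jacksonMean_clipCos_le_linear {L : ℕ} (hL : 1 ≤ L) (θ : ℝ) :
    |(1 / ∫ v in (-π)..π, fejerKernel L v ^ 2) *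
        ∫ v in (-π)..π, max (-1) (min 1 ((L : ℝ) * Real.cos (θ - v))) * fejerKernel L v ^ 2| ≤ (L : ℝ) * |θ - π / 2| := by
  have h0 := jacksonMean_clipCos_pi_div_two L (∫ v in (-π)..π, fejerKernel L v ^ 2)
  have hLip := Summit.QuantumFields.YangMills.Theorems.BalabanUVNodesN19JacksonKernelMean.abs_jacksonMean_sub_jacksonMean_le
    (f := fun t : ℝ => max (-1) (min 1 ((L : ℝ) * Real.cos t))) (continuous_clipCos L) (abs_clipCos_sub_clipCos_le L) hL θ (π / 2)
  rw [h0, sub_zero] at hLip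
  exact hLip

/-- Jordan: `|θ − π∕2| ≤ (π∕2)·|cos θ|` for `θ ∈ [0, π]`. [folklore] -/
theorem abs_sub_pi_div_two_le {θ : ℝ} (h0 : 0 ≤ θ) (hπ : θ ≤ π) : |θ - π / 2| ≤ π / 2 * |Real.cos θ| := by
  have hpi := Real.pi_pos
  have hcos : Real.cos θ = Real.sin (π / 2 - θ) := by rw [Real.sin_pi_div_two_sub]
  rcases le_total θ (π / 2) with h | h
  · have hy0 : 0 ≤ π / 2 - θ := by linarith
    have hy1 : π / 2 - θ ≤ π / 2 := by linarith
    have hj := Real.mul_le_sin hy0 hy1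
    rw [abs_of_nonpos (by linarith), hcos, abs_of_nonneg ((by positivity : (0:ℝ) ≤ 2 / π * (π / 2 - θ)).trans hj)]
    have : π / 2 * (2 / π * (π / 2 - θ)) ≤ π / 2 * Real.sin (π / 2 - θ) := mul_le_mul_of_nonneg_left hj (by positivity)
    have e : π / 2 * (2 / π * (π / 2 - θ)) = π / 2 - θ := by field_simp
    linarith
  · have hy0 : 0 ≤ θ - π / 2 := by linarith
    have hy1 : θ - π / 2 ≤ π / 2 := by linarith
    have hj := Real.mul_le_sin hy0 hy1
    have hsin : Real.sin (π / 2 - θ) = -Real.sin (θ - π / 2) := by rw [← Real.sin_neg]; ring_nf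
    rw [abs_of_nonneg hy0, hcos, hsin, abs_neg, abs_of_nonneg ((by positivity : (0:ℝ) ≤ 2 / π * (θ - π / 2)).trans hj)]
    have : π / 2 * (2 / π * (θ - π / 2)) ≤ π / 2 * Real.sin (θ - π / 2) := mul_le_mul_of_nonneg_left hj (by positivity)
    have e : π / 2 * (2 / π * (θ - π / 2)) = θ - π / 2 := by field_simp
    linarith

/-- ★ **THE SIGN POLYNOMIAL IS `(π∕2)L`-LIPSCHITZ AT THE KINK**: for every `L ≥ 1` there is a real polynomial `r` of degree `≤ 2L − 2` with, on `[−1,1]`,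
`|r(x)| ≤ 1`, `|sgn x − r(x)| ≤ (π⁷∕3)∕(L|x|)³` (`x ≠ 0`) AND `|r(x)| ≤ (π∕2)·L·|x|` (the same `r` as in `exists_poly_near_sign_localized`: the Jackson mean
of the clipped cosine, `|J_Lg_L(θ)| ≤ L|θ − π∕2| ≤ (π∕2)L|cos θ|`). [folklore] -/
theorem exists_poly_near_sign_localized_linear {L : ℕ} (hL : 1 ≤ L) :
    ∃ r : ℝ[X], r.natDegree ≤ 2 * L - 2 ∧ (∀ x : ℝ, x ∈ Set.Icc (-1 : ℝ) 1 → |r.eval x| ≤ 1) ∧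
      (∀ x : ℝ, x ∈ Set.Icc (-1 : ℝ) 1 → x ≠ 0 → |Real.sign x - r.eval x| ≤ (π ^ 7 / 3) / ((L : ℝ) * |x|) ^ 3) ∧
      ∀ x : ℝ, x ∈ Set.Icc (-1 : ℝ) 1 → |r.eval x| ≤ π / 2 * L * |x| := by
  have hπ := Real.pi_pos
  have hπ3 : (3 : ℝ) < π := Real.pi_gt_three
  have hLr : (0 : ℝ) < L := by exact_mod_cast hL
  have abs_sign_le_one : ∀ y : ℝ, |Real.sign y| ≤ 1 := fun y => by
    rcases Real.sign_apply_eq y with h | h | h <;> rw [h] <;> norm_num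
  set Z : ℝ := ∫ v in (-π)..π, fejerKernel L v ^ 2 with hZ
  obtain ⟨r, hdeg, hr⟩ := exists_chebyshev_eval_eq_jacksonMean (continuous_clipCos L) (periodic_clipCos L) (clipCos_neg L) hL Z
  refine ⟨r, hdeg, fun x hx => ?_, fun x hx hx0 => ?_, fun x hx => ?_⟩
  · rw [← Real.cos_arccos hx.1 hx.2, ← hr]
    exact abs_jacksonMean_le (abs_clipCos_le L) hL _
  · set θ : ℝ := Real.arccos x with hθ
    have hcos : Real.cos θ = x := Real.cos_arccos hx.1 hx.2
    have habs : 0 < |x| := abs_pos.2 hx0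
    have hx1 : |x| ≤ 1 := abs_le.2 ⟨hx.1, hx.2⟩
    by_cases hbig : 2 / (L : ℝ) ≤ |x|
    · have hxθ : 2 / (L : ℝ) ≤ |Real.cos θ| := by rw [hcos]; exact hbig
      have hloc : ∀ v : ℝ, |v| ≤ |x| / 2 → max (-1) (min 1 ((L : ℝ) * Real.cos (θ - v))) = Real.sign x := by
        intro v hv
        rw [← hcos] at hv ⊢
        exact clipCos_eq_sign hL hxθ hv
      have key := abs_jacksonMean_sub_le_of_locallyConst (continuous_clipCos L) (abs_clipCos_le L) hL
        (θ := θ) (σ := Real.sign x) (δ := |x| / 2) (by positivity) (by linarith) hloc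
      rw [hr θ, hcos] at key
      rw [abs_sub_comm]
      refine key.trans (le_of_eq ?_)
      field_simp
      ring
    · rw [not_le] at hbig
      have h2 : |Real.sign x - r.eval x| ≤ 2 := by
        calc |Real.sign x - r.eval x| ≤ |Real.sign x| + |r.eval x| := abs_sub _ _
          _ ≤ 1 + 1 := add_le_add (abs_sign_le_one x) (by
              rw [← hcos, ← hr]; exact abs_jacksonMean_le (abs_clipCos_le L) hL _)
          _ = 2 := by norm_num
      refine h2.trans ?_
      rw [le_div_iff₀ (by positivity)]
      have hLx : (L : ℝ) * |x| < 2 := by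
        have := mul_lt_mul_of_pos_left hbig hLr
        rwa [mul_div_cancel₀ _ hLr.ne'] at this
      have hLx0 : 0 ≤ (L : ℝ) * |x| := by positivity
      have h8 : ((L : ℝ) * |x|) ^ 3 ≤ 8 := by
        have := pow_le_pow_left₀ hLx0 hLx.le 3
        norm_num at this; exact this
      have hπ7 : (2187 : ℝ) ≤ π ^ 7 := by
        have : (3 : ℝ) ^ 7 ≤ π ^ 7 := pow_le_pow_left₀ (by norm_num) hπ3.le 7
        norm_num at this; linarith
      nlinarith [h8, hπ7]
  · set θ : ℝ := Real.arccos x with hθ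
    have hcos : Real.cos θ = x := Real.cos_arccos hx.1 hx.2
    rw [← hcos, ← hr θ]
    refine (abs_jacksonMean_clipCos_le_linear hL θ).trans ?_
    have hj := abs_sub_pi_div_two_le (Real.arccos_nonneg x) (Real.arccos_le_pi x)
    calc (L : ℝ) * |θ - π / 2| ≤ L * (π / 2 * |Real.cos θ|) := mul_le_mul_of_nonneg_left hj hLr.le
      _ = π / 2 * L * |Real.cos θ| := by ring

/-- ★★ **THE KINK-EXACT APPROXIMANT VANISHES QUADRATICALLY AT THE KINK**: for every `L ≥ 1` there is a real polynomial `p` of degree `≤ 2L − 1` with,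
on `[−1,1]`: `|p(x)| ≤ |x|`, `||x| − p(x)| ≤ 2|x|`, `||x| − p(x)| ≤ (π⁷∕3)∕(L³x²)` (`x ≠ 0`), AND `|p(x)| ≤ (π∕2)·L·x²` (`p = X·r` with the `r` of
`exists_poly_near_sign_localized_linear`).  Consequently the dyadic increments satisfy `|p_{2L}(x) − p_L(x)| ≤ (3π∕2)·L·x²`: a coordinate at scale `2^{−j}`
loads a coarser level `l < j` only by `≍ 4^{l−j}` of that level's range. [folklore] -/
theorem exists_kinkExact_poly_near_abs_quadratic {L : ℕ} (hL : 1 ≤ L) :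
    ∃ p : ℝ[X], p.natDegree ≤ 2 * L - 1 ∧ (∀ x : ℝ, x ∈ Set.Icc (-1 : ℝ) 1 → |p.eval x| ≤ |x|) ∧
      (∀ x : ℝ, x ∈ Set.Icc (-1 : ℝ) 1 → |(|x|) - p.eval x| ≤ 2 * |x|) ∧
      (∀ x : ℝ, x ∈ Set.Icc (-1 : ℝ) 1 → x ≠ 0 → |(|x|) - p.eval x| ≤ (π ^ 7 / 3) / ((L : ℝ) ^ 3 * x ^ 2)) ∧
      ∀ x : ℝ, x ∈ Set.Icc (-1 : ℝ) 1 → |p.eval x| ≤ π / 2 * L * x ^ 2 := by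
  have hLr : (0 : ℝ) < L := by exact_mod_cast hL
  have abs_sign_le_one : ∀ y : ℝ, |Real.sign y| ≤ 1 := fun y => by
    rcases Real.sign_apply_eq y with h | h | h <;> rw [h] <;> norm_num
  obtain ⟨r, hdeg, hr1, hr2, hr3⟩ := exists_poly_near_sign_localized_linear hL
  have hev : ∀ x : ℝ, (Polynomial.X * r).eval x = x * r.eval x := fun x => by rw [Polynomial.eval_mul, Polynomial.eval_X]
  have hkey : ∀ x : ℝ, |x| - (Polynomial.X * r).eval x = x * (Real.sign x - r.eval x) := fun x => by
    rw [hev, mul_sub, self_mul_sign_eq_abs]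
  refine ⟨Polynomial.X * r, ?_, fun x hx => ?_, fun x hx => ?_, fun x hx hx0 => ?_, fun x hx => ?_⟩
  · refine (Polynomial.natDegree_mul_le).trans ?_
    rw [Polynomial.natDegree_X]
    omega
  · rw [hev, abs_mul]
    exact mul_le_of_le_one_right (abs_nonneg x) (hr1 x hx)
  · rw [hkey, abs_mul]
    have h2 : |Real.sign x - r.eval x| ≤ 2 := by
      calc |Real.sign x - r.eval x| ≤ |Real.sign x| + |r.eval x| := abs_sub _ _
        _ ≤ 1 + 1 := add_le_add (abs_sign_le_one x) (hr1 x hx)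
        _ = 2 := by norm_num
    calc |x| * |Real.sign x - r.eval x| ≤ |x| * 2 := mul_le_mul_of_nonneg_left h2 (abs_nonneg x)
      _ = 2 * |x| := by ring
  · rw [hkey, abs_mul]
    have habs : 0 < |x| := abs_pos.2 hx0
    calc |x| * |Real.sign x - r.eval x| ≤ |x| * ((π ^ 7 / 3) / ((L : ℝ) * |x|) ^ 3) :=
          mul_le_mul_of_nonneg_left (hr2 x hx hx0) (abs_nonneg x)
      _ = (π ^ 7 / 3) / ((L : ℝ) ^ 3 * x ^ 2) := by
          rw [← sq_abs x]; field_simp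
  · rw [hev, abs_mul]
    calc |x| * |r.eval x| ≤ |x| * (π / 2 * L * |x|) := mul_le_mul_of_nonneg_left (hr3 x hx) (abs_nonneg x)
      _ = π / 2 * L * x ^ 2 := by rw [← sq_abs x]; ring

end Summit.QuantumFields.YangMills.Theorems.BalabanUVNodesN19KinkExactQuadraticVanishing

end
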